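import Summits.Ventures.HodgeRepro.Night3GSetLexBasis

/-!
# The Künneth component projection on the `G`-set model: `κ (ℓ_σ(n + k)) = ℓ_σ(n) ⊗ ℓ_σ(k)`, and `κ` is the left inverse
of the exterior cross product on the `(n, k)`-component

Blind re-derivation cell `pub-hodge-repro`, seat `night-3` (gen 4).  Imports night-3's `Night3GSetLexBasis` (the
lex-ordered wedge basis `wedgeBasis n` of `Hn G n = ⋀^n ℂ^{Fin n × G}`, the blocks, the `σ`-lines `line n σ` as basis
vectors).  Namespace `HodgeRepro.Night3.GSetModel`.

For night-3's abstract Weil model (`Night3WeilModel`) this file provides the CONCRETE Künneth map: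

* `kun n k : Hn G (n + k) →ₗ[ℂ] Hn G n ⊗[ℂ] Hn G k` — the Künneth component projection
  `H^{n+k}(B_M × B_N) → H^n(B_M) ⊗ H^k(B_N)` in eigen-coordinates: on the lex-ordered wedge basis
  `e_S ↦ e_{S ∩ block₁} ⊗ e_{S ∩ block₂}` when block 1 holds exactly `n` elements of `S` (then block 2 exactly `k`),
  `e_S ↦ 0` otherwise (the other Künneth components);
* **`kun_line`** — `kun n k (line (n + k) σ) = line n σ ⊗ₜ line k σ`: the eigenline identification `hℓ` of the Weil
  model, `ℓ_σ(B_M × B_N) = ℓ_σ(B_M) ⊗ ℓ_σ(B_N)`, is a theorem;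
* the honesty of `kun` as THE Künneth projection: `coe_wedgeBasis_blocksUnionPC` — in the exterior algebra
  `e_{inl S₁ ⊔ inr S₂} = (map inlMap e_{S₁}) * (map inrMap e_{S₂})` with sign `+1` (in the lex order block 1 precedes
  block 2, so the increasing enumeration of the union is the concatenation: `ExteriorAlgebra.ιMulti_mul_ιMulti`,
  `Fin.append`), hence `kun_of_coe_eq_mul`: `kun (x) = e_{S₁} ⊗ e_{S₂}` whenever `x` is that cross product — `kun` is the
  left inverse of the exterior cross product on the `(n, k)`-component (`kun_wedgeBasis_blocksUnion`) and kills every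
  basis vector of another component (`kun_wedgeBasis_of_ne`); and `coe_line_add` — the `σ`-line of the product is the
  product of the `σ`-lines of the factors (night-1's `coe_weilWedgeProd_sumEnum` in these coordinates).

Nothing geometric is built; nothing here says anything about the status of the Hodge conjecture for CM abelian
varieties, which is NOT proved.
-/

set_option autoImplicit false

open Finset Module
open scoped TensorProduct

namespace HodgeRepro.Night3.GSetModel

open HodgeRepro.CMHodgeOn

section Kunneth

variable {G : Type*} [Fintype G] [DecidableEq G] [LinearOrder G]

/-- **The Künneth component projection** `H^{n+k}(B_M × B_N) → H^n(B_M) ⊗ H^k(B_N)` in eigen-coordinates: on the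
lex-ordered wedge basis, `e_S ↦ e_{S ∩ block₁} ⊗ e_{S ∩ block₂}` when block 1 holds exactly `n` and block 2 exactly `k`
elements of `S`, and `e_S ↦ 0` otherwise (the other Künneth components). -/
noncomputable def kun (n k : ℕ) : Hn G (n + k) →ₗ[ℂ] Hn G n ⊗[ℂ] Hn G k :=
  (wedgeBasis (n + k)).constr ℂ fun S =>
    if h : (block₁ n k (S : Finset (Lex (Fin (n + k) × G)))).card = n ∧
        (block₂ n k (S : Finset (Lex (Fin (n + k) × G)))).card = k then
      wedgeBasis n (toPC _ h.1) ⊗ₜ[ℂ] wedgeBasis k (toPC _ h.2)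
    else 0

/-- `kun` on a basis vector, by definition. -/
theorem kun_wedgeBasis (n k : ℕ) (S : Set.powersetCard (Lex (Fin (n + k) × G)) (n + k)) :
    kun n k (wedgeBasis (n + k) S) =
      if h : (block₁ n k (S : Finset (Lex (Fin (n + k) × G)))).card = n ∧
          (block₂ n k (S : Finset (Lex (Fin (n + k) × G)))).card = k then
        wedgeBasis n (toPC _ h.1) ⊗ₜ[ℂ] wedgeBasis k (toPC _ h.2)
      else 0 := by
  rw [kun, Basis.constr_basis]

/-- **The eigenline identification `hℓ`, on the kernel**: `κ (ℓ_σ(n + k)) = ℓ_σ(n) ⊗ ℓ_σ(k)`. -/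
theorem kun_line (n k : ℕ) (σ : G) : kun n k (line (n + k) σ) = line n σ ⊗ₜ[ℂ] line k σ := by
  rw [← wedgeBasis_lineSet, kun_wedgeBasis]
  have h1 : (block₁ n k (lineSet (n + k) σ : Finset (Lex (Fin (n + k) × G)))).card = n := by
    rw [block₁_lineSet]; exact (lineSet n σ).prop
  have h2 : (block₂ n k (lineSet (n + k) σ : Finset (Lex (Fin (n + k) × G)))).card = k := by
    rw [block₂_lineSet]; exact (lineSet k σ).prop
  rw [dif_pos ⟨h1, h2⟩, ← wedgeBasis_lineSet n σ, ← wedgeBasis_lineSet k σ]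
  congr 2 <;> exact Subtype.ext (by simp only [coe_toPC, block₁_lineSet, block₂_lineSet])

/-- **`kun` on a product basis vector**: `kun (e_{inl S₁ ⊔ inr S₂}) = e_{S₁} ⊗ e_{S₂}`. -/
theorem kun_wedgeBasis_blocksUnion (n k : ℕ) (S₁ : Set.powersetCard (Lex (Fin n × G)) n)
    (S₂ : Set.powersetCard (Lex (Fin k × G)) k) :
    kun n k (wedgeBasis (n + k) (blocksUnionPC n k S₁ S₂)) = wedgeBasis n S₁ ⊗ₜ[ℂ] wedgeBasis k S₂ := by
  rw [kun_wedgeBasis]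
  have h1 : (block₁ n k (blocksUnionPC n k S₁ S₂ : Finset (Lex (Fin (n + k) × G)))).card = n := by
    simp only [blocksUnionPC, coe_toPC, block₁_blocksUnion, Set.powersetCard.card_eq]
  have h2 : (block₂ n k (blocksUnionPC n k S₁ S₂ : Finset (Lex (Fin (n + k) × G)))).card = k := by
    simp only [blocksUnionPC, coe_toPC, block₂_blocksUnion, Set.powersetCard.card_eq]
  rw [dif_pos ⟨h1, h2⟩]
  congr 2 <;> exact Subtype.ext (by simp only [coe_toPC, blocksUnionPC, block₁_blocksUnion, block₂_blocksUnion])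

/-- **`kun` kills the other Künneth components**: a basis vector whose block-1 part does not have exactly `n`
elements goes to `0`. -/
theorem kun_wedgeBasis_of_ne (n k : ℕ) (S : Set.powersetCard (Lex (Fin (n + k) × G)) (n + k))
    (hS : (block₁ n k (S : Finset (Lex (Fin (n + k) × G)))).card ≠ n) : kun n k (wedgeBasis (n + k) S) = 0 := by
  rw [kun_wedgeBasis, dif_neg (fun h => hS h.1)]

omit [Fintype G] in
/-- The increasing enumeration of `inl S₁ ⊔ inr S₂` is the concatenation of the increasing enumerations of `S₁` and
`S₂` (block 1 precedes block 2). -/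
theorem ofFinEmbEquiv_symm_blocksUnionPC (n k : ℕ) (S₁ : Set.powersetCard (Lex (Fin n × G)) n)
    (S₂ : Set.powersetCard (Lex (Fin k × G)) k) :
    ⇑(Set.powersetCard.ofFinEmbEquiv.symm (blocksUnionPC n k S₁ S₂)) =
      Fin.append (inlEmb n k ∘ Set.powersetCard.ofFinEmbEquiv.symm S₁)
        (inrEmb n k ∘ Set.powersetCard.ofFinEmbEquiv.symm S₂) := by
  rw [Set.powersetCard.ofFinEmbEquiv_symm_apply]
  refine (Finset.orderEmbOfFin_unique (blocksUnionPC n k S₁ S₂).prop (fun i => ?_) ?_).symm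
  · refine Fin.addCases (fun a => ?_) (fun b => ?_) i
    · rw [Fin.append_left]
      exact (mem_blocksUnion n k _ _ _).mpr (Or.inl ⟨_, (Set.powersetCard.mem_range_ofFinEmbEquiv_symm_iff_mem S₁ _).mp
        ⟨a, rfl⟩, rfl⟩)
    · rw [Fin.append_right]
      exact (mem_blocksUnion n k _ _ _).mpr (Or.inr ⟨_, (Set.powersetCard.mem_range_ofFinEmbEquiv_symm_iff_mem S₂ _).mp
        ⟨b, rfl⟩, rfl⟩)
  · intro i j hij
    revert hij
    refine Fin.addCases (fun a => ?_) (fun b => ?_) i <;> refine Fin.addCases (fun a' => ?_) (fun b' => ?_) j <;>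
      intro hij
    · rw [Fin.append_left, Fin.append_left]
      exact strictMono_inlEmb n k ((Set.powersetCard.ofFinEmbEquiv.symm S₁).strictMono
        ((Fin.strictMono_castAdd k).lt_iff_lt.mp hij))
    · rw [Fin.append_left, Fin.append_right]
      exact inlEmb_lt_inrEmb n k _ _
    · exfalso
      have h1 : (Fin.natAdd n b).val < (Fin.castAdd k a').val := hij
      rw [Fin.val_natAdd, Fin.val_castAdd] at h1
      have := a'.isLt
      omega
    · rw [Fin.append_right, Fin.append_right]
      exact strictMono_inrEmb n k ((Set.powersetCard.ofFinEmbEquiv.symm S₂).strictMono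
        ((Fin.strictMono_natAdd n).lt_iff_lt.mp hij))

/-- **The exterior cross product in coordinates**: in the exterior algebra, `e_{inl S₁ ⊔ inr S₂}` is the product of the
images of `e_{S₁}` and `e_{S₂}` under the extensions by zero, with sign `+1`. -/
theorem coe_wedgeBasis_blocksUnionPC (n k : ℕ) (S₁ : Set.powersetCard (Lex (Fin n × G)) n)
    (S₂ : Set.powersetCard (Lex (Fin k × G)) k) :
    (wedgeBasis (n + k) (blocksUnionPC n k S₁ S₂) : ExteriorAlgebra ℂ (V G (n + k))) =
      ExteriorAlgebra.map (inlMap n k) (wedgeBasis n S₁) * ExteriorAlgebra.map (inrMap n k) (wedgeBasis k S₂) := by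
  simp only [wedgeBasis_apply, exteriorPower.ιMulti_apply_coe, ExteriorAlgebra.map_apply_ιMulti,
    ExteriorAlgebra.ιMulti_mul_ιMulti, ofFinEmbEquiv_symm_blocksUnionPC]
  congr 1
  funext i
  refine Fin.addCases (fun a => ?_) (fun b => ?_) i
  · rw [Fin.append_left, Fin.append_left]
    simp only [Function.comp_apply, inlMap_coordVecOn]
    rfl
  · rw [Fin.append_right, Fin.append_right]
    simp only [Function.comp_apply, inrMap_coordVecOn]
    rfl

/-- **`kun ∘ (cross product) = id` on `⋀^n ⊗ ⋀^k`** (basis form): the Künneth projection is the left inverse of the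
exterior cross product on the `(n, k)`-component. -/
theorem kun_of_coe_eq_mul (n k : ℕ) (S₁ : Set.powersetCard (Lex (Fin n × G)) n)
    (S₂ : Set.powersetCard (Lex (Fin k × G)) k) (x : Hn G (n + k))
    (hx : (x : ExteriorAlgebra ℂ (V G (n + k))) =
      ExteriorAlgebra.map (inlMap n k) (wedgeBasis n S₁) * ExteriorAlgebra.map (inrMap n k) (wedgeBasis k S₂)) :
    kun n k x = wedgeBasis n S₁ ⊗ₜ[ℂ] wedgeBasis k S₂ := by
  have : x = wedgeBasis (n + k) (blocksUnionPC n k S₁ S₂) :=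
    Subtype.ext (hx.trans (coe_wedgeBasis_blocksUnionPC n k S₁ S₂).symm)
  rw [this, kun_wedgeBasis_blocksUnion]

/-- The `σ`-line of the product is the product of the `σ`-lines of the factors, in the exterior algebra
(night-1's `coe_weilWedgeProd_sumEnum` in these coordinates). -/
theorem coe_line_add (n k : ℕ) (σ : G) :
    (line (n + k) σ : ExteriorAlgebra ℂ (V G (n + k))) =
      ExteriorAlgebra.map (inlMap n k) (line n σ) * ExteriorAlgebra.map (inrMap n k) (line k σ) := by
  rw [← wedgeBasis_lineSet, ← wedgeBasis_lineSet, ← wedgeBasis_lineSet, lineSet_add,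
    coe_wedgeBasis_blocksUnionPC]

end Kunneth

end HodgeRepro.Night3.GSetModel
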